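import Summits.HubbardSuperconductivity.HubbardSuperconductivity.Theorems.ThermalWedgeTwSourcedInertnessReduction
import Literature.MathematicalPhysics.QuantumLattice.DWaveOrderParameterProofs
import Literature.MathematicalPhysics.QuantumLattice.DWaveSourceFreePressure
import Literature.MathematicalPhysics.QuantumLattice.LiebFluxPhaseProofs

/-!
# Crux `CwChiralConstruction` (item `stmt-HubbardSuperconductivity-1740`, route `ChiralWindow`):
# a stair of the `d`-wave order parameter is bounded by the free sourced pressure gain

Negative-side support lemmas from the standing disprover (cdisprove, cycle 1), part 1 of 2 (part 2:
`CooperLegendreCeiling.lean`). For the sourced torus `H_L(U,μ,h) = dWaveSourceTorus L U μ h`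
(`= H(1,U) - μN - h(Δ_d + Δ_dᴴ)`), ground energies `E`, partition functions `Z_β`, all `L ≥ 1`:

* `neg_log_partitionFn_div_le_groundEnergy`, `groundEnergy_le_log_card_sub_log_partitionFn_div` —
  the elementary sandwich `-log Z_β/β ≤ E₀ ≤ (log dim - log Z_β)/β` (any Hermitian matrix);
* `log_card_fock` — `log dim Fock((ℤ/Lℤ)²) = 2L² log 2`;
* `abs_log_partitionFn_interacting_sub_free_le` — `|log Z_β(H_L(U,μ,h)) - log Z_β(H_L(0,μ,h))| ≤ β|U|L²`
  (Peierls–Bogoliubov Lipschitz bound and `‖H_L(U) - H_L(0)‖ ≤ |U|L²`, the latter REUSED from route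
  ThermalWedge's `ThermalWedgeTwSourcedInertnessReduction`, as is `isHermitian_dWaveSourceTorus`);
* `groundEnergy_drop_le_logPartitionFn` — `E(U,μ,0) - E(U,μ,2h) ≤ (log Z(U,2h) - log Z(U,0))/β + 2L² log 2/β`;
* `dWaveSourceDensity_le_freeGain` — the STAIR BOUND
  `dWaveSourceDensity L U μ h ≤ [(log Z(0,2h) - log Z(0,0))/β + 2|U|L² + 2L² log 2/β] / (2hL²)`
  for every `h > 0`, `β > 0`: a stair of the Koma–Tasaki order parameter is controlled by the FREE
  sourced pressure gain, the coupling, and an entropy term `log 2/(βh)`.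

Sources: T. Koma, H. Tasaki, J. Stat. Phys. 76 (1994) 745, §1 (order parameter under a source; energy
sandwich of a stair) [KomaTasaki1994]; Bratteli–Robinson II §5.3 (`Z` versus `E₀`; Peierls–Bogoliubov).
Tree: `dWaveSourceDensity_le_energyDrop_div`, `groundEnergy_dWaveSourceTorus_le` (DWaveSource API),
`exp_neg_mul_groundEnergy_le_partitionFn`, `partitionFn_le_card_mul_exp` (LiebFluxPhaseProofs),
`abs_log_partitionFn_sub_log_partitionFn_le` (ApproximatingHamiltonianProofs),
`norm_dWaveSourceTorus_sub_free_le`, `isHermitian_dWaveSourceTorus` (ThermalWedge reduction file).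
-/

noncomputable section

namespace Summit.HubbardSuperconductivity.CwChiralConstruction.Negative

open Matrix Finset Filter Literature.MathematicalPhysics.QuantumLattice Literature.Probability.LatticeModels
open Summit.HubbardSuperconductivity.HubbardSuperconductivity.Theorems
open scoped Matrix.Norms.L2Operator ComplexOrder Topology

/-! ### `Z` versus `E₀` -/

section Spectral

variable {m : Type*} [Fintype m] [DecidableEq m] [Nonempty m]

/-- `-log Re Z_β / β ≤ E₀` (keep the ground-state term of `Z`). [folklore] -/
theorem neg_log_partitionFn_div_le_groundEnergy {H : Matrix m m ℂ} (hH : H.IsHermitian) {β : ℝ}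
    (hβ : 0 < β) : -Real.log (H.partitionFn β).re / β ≤ H.groundEnergy := by
  have h1 := exp_neg_mul_groundEnergy_le_partitionFn hH β
  have h2 := Real.log_le_log (Real.exp_pos _) h1
  rw [Real.log_exp] at h2
  rw [div_le_iff₀ hβ]
  linarith

/-- `E₀ ≤ (log dim - log Re Z_β) / β` (`Z ≤ dim · e^{-βE₀}`). [folklore] -/
theorem groundEnergy_le_log_card_sub_log_partitionFn_div {H : Matrix m m ℂ} (hH : H.IsHermitian)
    {β : ℝ} (hβ : 0 < β) :
    H.groundEnergy ≤ (Real.log (Fintype.card m) - Real.log (H.partitionFn β).re) / β := by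
  have h1 := partitionFn_le_card_mul_exp hH hβ.le
  have hpos : 0 < (H.partitionFn β).re :=
    lt_of_lt_of_le (Real.exp_pos _) (exp_neg_mul_groundEnergy_le_partitionFn hH β)
  have hD : (0 : ℝ) < Fintype.card m := by exact_mod_cast Fintype.card_pos
  have h2 := Real.log_le_log hpos h1
  rw [Real.log_mul hD.ne' (Real.exp_pos _).ne', Real.log_exp] at h2
  rw [le_div_iff₀ hβ]
  linarith

end Spectral

/-! ### The sourced torus: dimension, interacting versus free, the stair bound -/

section Torus

variable (L : ℕ) [NeZero L]

omit [NeZero L] in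
/-- `log dim Fock((ℤ/Lℤ)²) = 2L² log 2`. [folklore] -/
theorem log_card_fock :
    Real.log (Fintype.card (Finset (Orb (FermionTorus 2 L))) : ℝ) = 2 * (L : ℝ) ^ 2 * Real.log 2 := by
  rw [Fintype.card_finset, card_orb_fermionTorus_two]
  push_cast
  rw [Real.log_pow]
  push_cast
  ring

/-- **Interacting versus free partition function**: `|log Z_β(H_L(U,μ,h)) - log Z_β(H_L(0,μ,h))| ≤ β|U|L²`
(Peierls–Bogoliubov Lipschitz bound). [folklore] -/
theorem abs_log_partitionFn_interacting_sub_free_le (U μ h : ℝ) {β : ℝ} (hβ : 0 < β) :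
    |Real.log (partitionFn β (dWaveSourceTorus L U μ h)).re -
        Real.log (partitionFn β (dWaveSourceTorus L 0 μ h)).re| ≤ β * (|U| * (L : ℝ) ^ 2) := by
  have key := abs_log_partitionFn_sub_log_partitionFn_le (isHermitian_dWaveSourceTorus L U μ h)
    (isHermitian_dWaveSourceTorus L 0 μ h) hβ.le
  exact key.trans (mul_le_mul_of_nonneg_left (norm_dWaveSourceTorus_sub_free_le L U μ h) hβ.le)

variable {L}

/-- **Energy drop through partition functions.** For every `β > 0`:
`E_L(U,μ,0) - E_L(U,μ,2h) ≤ (log Z_β(U,2h) - log Z_β(U,0))/β + 2L² log 2/β`. [cite: KomaTasaki1994, §1] -/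
theorem groundEnergy_drop_le_logPartitionFn (U μ h : ℝ) {β : ℝ} (hβ : 0 < β) :
    (dWaveSourceTorus L U μ 0).groundEnergy - (dWaveSourceTorus L U μ (2 * h)).groundEnergy ≤
      (Real.log (partitionFn β (dWaveSourceTorus L U μ (2 * h))).re -
          Real.log (partitionFn β (dWaveSourceTorus L U μ 0)).re) / β +
        2 * (L : ℝ) ^ 2 * Real.log 2 / β := by
  have h0 := groundEnergy_le_log_card_sub_log_partitionFn_div (isHermitian_dWaveSourceTorus L U μ 0) hβ
  have h2 := neg_log_partitionFn_div_le_groundEnergy (isHermitian_dWaveSourceTorus L U μ (2 * h)) hβ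
  rw [log_card_fock] at h0
  set a := Real.log (partitionFn β (dWaveSourceTorus L U μ (2 * h))).re
  set b := Real.log (partitionFn β (dWaveSourceTorus L U μ 0)).re
  have e1 : (a - b) / β + 2 * (L : ℝ) ^ 2 * Real.log 2 / β =
      (2 * (L : ℝ) ^ 2 * Real.log 2 - b) / β - (-a / β) := by ring
  rw [e1]
  linarith

/-- **The stair bound.** For `h > 0`, `β > 0` and every `L`:
`dWaveSourceDensity L U μ h ≤ [(log Z_β(0,2h) - log Z_β(0,0))/β + 2|U|L² + 2L² log 2/β] / (2hL²)`:
a stair of the order parameter is controlled by the FREE sourced pressure gain at any inverse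
temperature, the coupling, and the entropy term. [cite: KomaTasaki1994, §1] -/
theorem dWaveSourceDensity_le_freeGain (U μ : ℝ) {h β : ℝ} (hh : 0 < h) (hβ : 0 < β) :
    dWaveSourceDensity L U μ h ≤
      ((Real.log (partitionFn β (dWaveSourceTorus L 0 μ (2 * h))).re -
          Real.log (partitionFn β (dWaveSourceTorus L 0 μ 0)).re) / β +
        2 * |U| * (L : ℝ) ^ 2 + 2 * (L : ℝ) ^ 2 * Real.log 2 / β) / (2 * h * (L : ℝ) ^ 2) := by
  have hL := cast_sq_pos_of_neZero L
  have h1 := dWaveSourceDensity_le_energyDrop_div (L := L) U μ hh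
  have h2 := groundEnergy_dWaveSourceTorus_le (L := L) U μ h
  have h3 := groundEnergy_drop_le_logPartitionFn (L := L) U μ h hβ
  have h4 := abs_log_partitionFn_interacting_sub_free_le L U μ (2 * h) hβ
  have h5 := abs_log_partitionFn_interacting_sub_free_le L U μ 0 hβ
  rw [abs_le] at h4 h5
  have hden : (0 : ℝ) ≤ 2 * h * (L : ℝ) ^ 2 := by positivity
  refine h1.trans (div_le_div_of_nonneg_right ?_ hden)
  -- `E(h) - E(2h) ≤ E(0) - E(2h) ≤ (log Z_U(2h) - log Z_U(0))/β + … ≤ (log Z_0(2h) - log Z_0(0))/β + 2|U|L² + …`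
  have h6 : (Real.log (partitionFn β (dWaveSourceTorus L U μ (2 * h))).re -
        Real.log (partitionFn β (dWaveSourceTorus L U μ 0)).re) / β ≤
      (Real.log (partitionFn β (dWaveSourceTorus L 0 μ (2 * h))).re -
          Real.log (partitionFn β (dWaveSourceTorus L 0 μ 0)).re) / β + 2 * |U| * (L : ℝ) ^ 2 := by
    rw [div_le_iff₀ hβ, add_mul, div_mul_cancel₀ _ hβ.ne']
    nlinarith [h4.2, h5.1]
  linarith

end Torus

end Summit.HubbardSuperconductivity.CwChiralConstruction.Negative

end
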